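import Literature.NumberTheory.PAdicHodge.TatePairingCochainLegendre
import Literature.NumberTheory.PAdicHodge.TeichLogCochainCorrection
import Literature.NumberTheory.PAdicHodge.BdRPlusLogTeichGalois
import Literature.NumberTheory.PAdicHodge.BdRPlusLogTeichUnit
import Literature.NumberTheory.PAdicHodge.UnitKummerLogPow
import HarnessLib

/-!
# Kato's recognition identity from the `X₂`-membership of the Legendre resolution (B_crys-free Lemma 1.4.3–1.4.5, assembly)

Topic `Literature/NumberTheory/PAdicHodge`; namespace `Literature.NumberTheory.PAdicHodge.BdRPlusTop`. THEOREMS ONLY (no definition, no named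
fact, no instance, no `sorry`). This file ASSEMBLES the `B₂`-road to Kato's explicit reciprocity law (LNM 1553, II Lemma 1.4.3–1.4.5) built on
crux K★ `stmt-BirchSwinnertonDyer-22226`, line `kato_lever`: given

* Legendre period data `Pω ⊆ Fil¹`, `Pη`, `Pω(S)Pη(T) − Pη(S)Pω(T) = ι(e_∞(S,T))` and an integrating pair `(b_ω, b_η)` of the cocycle `κ`
  with `θ(b_ω) = ι_F(c_P)` (`TatePairingCochainLegendre`: `g(σ) = Pη(ησ)·σb_ω − Pω(ησ)·σb_η` presents `η ∪ κ`; for Fontaine's integrating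
  element `c_P = log_ω P`),
* (HT) the Hodge–Tate reading of the dual exponential at the level of `ℂ_F`:
  `θ(Pη(η σ)) = θ(ψ σ) · ι_F(b) + (σ m − m)` (`ψ` a `ℤ_p`-lift of `log χ`, `b ∈ F`, `m ∈ ℂ_F`),
* (K₂) **the `X₂`-membership of the resolution cochain**: `p^N · x̃(η σ)` is a Teichmüller logarithm modulo `Fil²` for every `σ`
  (`x̃(a) = Pη(a) b_ω − Pω(a) b_η`), `p`-adically small near `σ = 1` — Kato's «`x ∈ X ⊗ V`», the one `B_crys`-type input left,

it PRODUCES the data `(k, u, h, z)` of the assembly socket `ReciprocityCalibrationSocket.tatePairingPoint_eq_neg_trace_of_recognition` with the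
recognition identity **`p^{k+1} · g(τ) ≡ ψ(τ) · ℓ_{u^p} + ι(h τ) + z(τ) (mod Fil²)`**, `log_p(u^p) = p^{k+1} · (c_P b)`, `h` CONTINUOUS,
`z` a cocycle (★★ `exists_recognition_of_isTeichLog`). Route: the error cochain
`E(σ) = p^{k−N}·(p^N x̃(ησ)) − ψ(σ)·Λ_u − p^{k−N'}(σM − M)` (`Λ_u = ℓ_u + ι_F(log_p u) ≡ log[ũ]`, `BdRPlusLogTeichUnit`; `M ∈ X⁰₂` with
`θ(M) = p^{N'} ι_F(c_P) m`, IMAGE) is `X⁰₂`-valued with `θ ∘ E = 0`, `p`-adically small near `1` (`BdRPlusLogTeichGalois`) and satisfies an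
exact twisted cochain identity, so `p · E ≡ ι ∘ h` with `h` continuous (`TeichLogCochainCorrection`); the power `u ↦ u^p` absorbs the factor
`p` of the uniform kernel (`UnitKummerLogPow`). So [REC] at a completion is reduced to (K₂) and (HT), with no `B_crys` and no `φ`.

BSD / K★ / [REC] are NOT proved by any of this: (K₂) and (HT) are HYPOTHESES here.

## References
* K. Kato, LNM 1553 (1993), Ch. II §1.2.4–1.2.5, Thm. 1.4.1, Lemma 1.4.3–1.4.5, §1.4.4. [Kato1993LNM1553]
* S. Bloch, K. Kato (1990), Def. 3.10, Ex. 3.10.1, Example 3.11. [BlochKato1990]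
* J.-M. Fontaine, Y. Ouyang, *Theory of p-adic Galois representations*, §6.1 (`(B_crys⁺)^{φ=p}` and the fundamental exact sequence). [FontaineOuyang2022]
* J. Neukirch, A. Schmidt, K. Wingberg (2008), I §3 (1.3.2), II §7. [NeukirchSchmidtWingberg2008]
-/

noncomputable section

open Field Function ValuativeRel WittVector
open scoped Topology

namespace Literature.NumberTheory.PAdicHodge

open Literature.NumberTheory.GaloisRepresentations
open Literature.NumberTheory.GaloisRepresentations.IsNonarchimedeanLocalField
open Literature.NumberTheory.GaloisCohomology
open Literature.NumberTheory.EllipticCurves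
open Literature.NumberTheory.PAdicHodge.GaloisContinuity
open Literature.IUT.LogVolume
open _root_.WeierstrassCurve

namespace BdRPlusTop

variable {F : Type} [Field F] [ValuativeRel F] [TopologicalSpace F] [IsNonarchimedeanLocalField F] [CharZero F]
  {p : ℕ} [Fact p.Prime] [Fact (¬ IsUnit (p : integerC F))] [IsAdicComplete (Ideal.span {(p : integerC F)}) (integerC F)]
  (hp : valuation F p < 1) (hF : Function.Surjective (fontaineTheta (integerC F) p))

/-! ## §1 The calibration element `Λ_u = ℓ_u + ι_F(log_p u)`: a Teichmüller logarithm with `θ(Λ_u) = ι_F(log_p u)`, `σΛ_u = Λ_u + a(σ)t` -/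

/-- ★ **`Λ_u = ℓ_u + ι_F(log_p u)` is a Teichmüller logarithm modulo `Fil^k`** for a unit `u ≡ 1 (mod p)` (`ũ₀ = 1`): it is congruent to
`log[ũ]` (`BdRPlusLogTeichUnit`). [cite: BlochKato1990, Ex. 3.10.1] [cite: FontaineOuyang2022, §6.1] -/
theorem isTeichLog_unitKummerLog_add_embBdRHom {u : F} (hu : u ≠ 0) (hu1 : ‖algebraMap F (NormedAlgClosure F) u‖ ≤ 1)
    (hx0 : PreTilt.coeff 0 (rootTilt p (algebraMap F (NormedAlgClosure F) u) hu1) = 1) {k : ℕ} (hk : 1 ≤ k) :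
    IsTeichLog k ((of F p).symm (unitKummerLog hp hF hu hu1) +
      embBdRHom hp hF (letI := PadicField.normedField F p hp; unitLog u)) := by
  have hyI := (teichmuller_sub_one_mem_span_p_xi_iff_coeff_zero (rootTilt p (algebraMap F (NormedAlgClosure F) u) hu1)).2 hx0
  obtain ⟨L, hL⟩ := GaloisContinuity.exists_isLogModFil hyI k
  have hmem := IsLogModFil.sub_unitKummerLog_sub_embBdRHom_unitLog_mem hp hF hu hu1 hx0 hk hL
  refine IsTeichLog.of_sub_mem ⟨_, hx0, hL⟩ ?_
  rw [← neg_sub]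
  exact (Ideal.neg_mem_iff _).2 hmem

/-- `θ(Λ_u) = ι_F(log_p u)` (`ℓ_u ∈ Fil¹ = ker θ`). [cite: BlochKato1990, Ex. 3.10.1] [cite: Kato1993LNM1553, Ch. II §1.4.4] -/
theorem thetaBdR_unitKummerLog_add_embBdRHom {u : F} (hu : u ≠ 0) (hu1 : ‖algebraMap F (NormedAlgClosure F) u‖ ≤ 1) :
    thetaBdR ((of F p).symm (unitKummerLog hp hF hu hu1) + embBdRHom hp hF (letI := PadicField.normedField F p hp; unitLog u)) =
      algebraMap F (CompletedAlgClosure F) (letI := PadicField.normedField F p hp; unitLog u) := by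
  have h0 : thetaBdR ((of F p).symm (unitKummerLog hp hF hu hu1)) = 0 := by
    rw [← RingHom.mem_ker, ker_thetaBdR_eq_span, ← mem_filOne_iff]
    exact kummerUnitLog_mem_filOne hp hF _ _ _ _
  rw [map_add, h0, zero_add, thetaBdR_embBdRHom]

/-- `σ(Λ_u) = Λ_u + a(σ) · t` with `a(σ) = kummerExp σ` (`σ ℓ_u = ℓ_u + a(σ)t`, `σ ι_F = ι_F`). [cite: BlochKato1990, Ex. 3.10.1]
[cite: Kato1993LNM1553, Ch. II §1.4.4] -/
theorem gal_unitKummerLog_add_embBdRHom {u : F} (hu : u ≠ 0) (hu1 : ‖algebraMap F (NormedAlgClosure F) u‖ ≤ 1)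
    (σ : absoluteGaloisGroup F) :
    gal F p σ (unitKummerLog hp hF hu hu1 + of F p (embBdRHom hp hF (letI := PadicField.normedField F p hp; unitLog u))) =
      (unitKummerLog hp hF hu hu1 + of F p (embBdRHom hp hF (letI := PadicField.normedField F p hp; unitLog u))) +
        of F p (qpToBdR (kummerExp (p := p) σ ((map_ne_zero_iff _ (algebraMap F (NormedAlgClosure F)).injective).2 hu)
          (NormedAlgClosure.smul_algebraMap σ u) : ℚ_[p]) * tBdR) := by
  rw [map_add, gal_of, galBdRPlus_embBdRHom, unitKummerLog,
    gal_kummerUnitLog_eq hp hF σ ((map_ne_zero_iff _ (algebraMap F (NormedAlgClosure F)).injective).2 hu) hu1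
      (NormedAlgClosure.smul_algebraMap σ u)]
  ring

/-! ## §2 The recognition identity from the `X₂`-membership of the resolution -/

section Recognition

variable {K₀ : Type} [Field K₀] [Algebra K₀ F] (W : WeierstrassCurve K₀)
  (e : (k : ℕ) → geomTorsion W ((p ^ k : ℕ) : ℤ) → geomTorsion W ((p ^ k : ℕ) : ℤ) → AlgebraicClosure K₀)
  (hμ : ∀ k S T, e k S T ^ (p ^ k) = 1) (hadd₁ : ∀ k S₁ S₂ T, e k (S₁ + S₂) T = e k S₁ T * e k S₂ T)
  (hadd₂ : ∀ k S T₁ T₂, e k S (T₁ + T₂) = e k S T₁ * e k S T₂)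
  (hgal : ∀ k (σ : absoluteGaloisGroup K₀) (S T : geomTorsion W ((p ^ k : ℕ) : ℤ)), σ • e k S T = e k (σ • S) (σ • T))
  (hcompat : ∀ k (S T : geomTorsion W ((p ^ (k + 1) : ℕ) : ℤ)),
    e k (torsionMulHom W (p ^ (k + 1)) (p ^ k) p (pow_succ p k).symm S)
      (torsionMulHom W (p ^ (k + 1)) (p ^ k) p (pow_succ p k).symm T) = e (k + 1) S T ^ p)
  {Pω Pη : W.tateModule p →+ BdRPlusTop F p}
  (hPω : ∀ (σ : absoluteGaloisGroup F) (a : W.tateModule p), gal F p σ (Pω a) = Pω (restrictedTateRep W F p σ a))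
  (hPη : ∀ (σ : absoluteGaloisGroup F) (a : W.tateModule p), gal F p σ (Pη a) = Pη (restrictedTateRep W F p σ a))
  (hLeg : ∀ S T : W.tateModule p, Pω S * Pη T - Pη S * Pω T =
    periodLine F p ((weilContPairingPadic W F p e hμ hadd₁ hadd₂ hgal hcompat).toLin S T))

/-- `p^n · L ∈ X⁰_k` for `L ∈ X⁰_k` (bookkeeping form of `IsTeichLog.natCast_mul`). [cite: FontaineOuyang2022, §6.1] -/
theorem _root_.Literature.NumberTheory.PAdicHodge.GaloisContinuity.IsTeichLog.prime_pow_mul {k : ℕ}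
    {L : BDeRhamPlus (integerC F) p} (hL : IsTeichLog k L) (n : ℕ) : IsTeichLog k ((p : BDeRhamPlus (integerC F) p) ^ n * L) := by
  rw [← Nat.cast_pow]; exact hL.natCast_mul _

include hPω hPη hLeg in
/-- **The twisted cochain identity of the error cochain.** For the Legendre resolution `x̃(a) = Pη(a) b_ω − Pω(a) b_η` of a cocycle `κ`
integrated by `(b_ω, b_η)`, an additive `ψ`, an element `Λ` with `σΛ = Λ + a(σ)·t` and any `M`, the cochain
`E(σ) = p^A · (p^N x̃(η σ)) − ψ(σ) · Λ − p^C (σM − M)` satisfies **`E(στ) = E(σ) + σE(τ) + ι(d(σ,τ))`** with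
`d(σ,τ) = ε^{ψ(τ) a(σ)} − p^{A+N} · e_∞(κ σ, σ η τ)` (`∂x̃ = κ`, the Legendre relation, `∂Λ = a·t`).
[cite: Kato1993LNM1553, Ch. II, proof of Lemma 1.4.3 and §1.4.4] [cite: NeukirchSchmidtWingberg2008, I §3 (1.3.2)] -/
theorem errorCochain_identity (η κ : contOneCocycles (restrictedTateRep W F p).toTopRep) {bω bη : BdRPlusTop F p}
    (hbω : ∀ τ, Pω (κ.1 τ) = gal F p τ bω - bω) (hbη : ∀ τ, Pη (κ.1 τ) = gal F p τ bη - bη)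
    (ψ : absoluteGaloisGroup F → ℤ_[p]) (hψ : ∀ σ τ, ψ (σ * τ) = ψ σ + ψ τ) {Λ M : BdRPlusTop F p} {a : absoluteGaloisGroup F → ℤ_[p]}
    (hΛgal : ∀ σ, gal F p σ Λ = Λ + of F p (qpToBdR (a σ : ℚ_[p]) * tBdR)) (A N C : ℕ) (σ τ : absoluteGaloisGroup F) :
    ((p : BdRPlusTop F p) ^ A * ((p : BdRPlusTop F p) ^ N * (Pη (η.1 (σ * τ)) * bω - Pω (η.1 (σ * τ)) * bη)) -
        of F p (qpToBdR ((ψ (σ * τ) : ℤ_[p]) : ℚ_[p])) * Λ - (p : BdRPlusTop F p) ^ C * (gal F p (σ * τ) M - M)) =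
      ((p : BdRPlusTop F p) ^ A * ((p : BdRPlusTop F p) ^ N * (Pη (η.1 σ) * bω - Pω (η.1 σ) * bη)) -
          of F p (qpToBdR ((ψ σ : ℤ_[p]) : ℚ_[p])) * Λ - (p : BdRPlusTop F p) ^ C * (gal F p σ M - M)) +
        galRepr F p σ ((p : BdRPlusTop F p) ^ A * ((p : BdRPlusTop F p) ^ N * (Pη (η.1 τ) * bω - Pω (η.1 τ) * bη)) -
          of F p (qpToBdR ((ψ τ : ℤ_[p]) : ℚ_[p])) * Λ - (p : BdRPlusTop F p) ^ C * (gal F p τ M - M)) +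
        periodLine F p (epsLineEquiv F p (ψ τ * a σ) -
          (((p ^ (A + N) : ℕ) : ℤ) • (weilContPairingPadic W F p e hμ hadd₁ hadd₂ hgal hcompat).toLin (κ.1 σ)
            (restrictedTateRep W F p σ (η.1 τ)))) := by
  have e3 : η.1 (σ * τ) = η.1 σ + restrictedTateRep W F p σ (η.1 τ) := η.2 σ τ
  have eω : gal F p σ bω = bω + Pω (κ.1 σ) := by rw [hbω]; ring
  have eη : gal F p σ bη = bη + Pη (κ.1 σ) := by rw [hbη]; ring
  have hL := hLeg (κ.1 σ) (restrictedTateRep W F p σ (η.1 τ))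
  have hgq : ∀ x : ℚ_[p], gal F p σ (of F p (qpToBdR x)) = of F p (qpToBdR x) := fun x => by rw [gal_of, galBdRPlus_qpToBdR]
  have hdι : periodLine F p (epsLineEquiv F p (ψ τ * a σ) -
      (((p ^ (A + N) : ℕ) : ℤ) • (weilContPairingPadic W F p e hμ hadd₁ hadd₂ hgal hcompat).toLin (κ.1 σ)
        (restrictedTateRep W F p σ (η.1 τ)))) =
      of F p (qpToBdR ((ψ τ : ℤ_[p]) : ℚ_[p])) * of F p (qpToBdR (a σ : ℚ_[p]) * tBdR) -
        (p : BdRPlusTop F p) ^ (A + N) *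
          periodLine F p ((weilContPairingPadic W F p e hμ hadd₁ hadd₂ hgal hcompat).toLin (κ.1 σ)
            (restrictedTateRep W F p σ (η.1 τ))) := by
    simp only [map_sub, map_zsmul, periodLine_epsLineEquiv, PadicInt.coe_mul, map_mul, zsmul_eq_mul, Int.cast_natCast,
      Int.cast_pow, Nat.cast_pow]
    ring
  have hgalE : gal F p σ ((p : BdRPlusTop F p) ^ A * ((p : BdRPlusTop F p) ^ N * (Pη (η.1 τ) * bω - Pω (η.1 τ) * bη)) -
        of F p (qpToBdR ((ψ τ : ℤ_[p]) : ℚ_[p])) * Λ - (p : BdRPlusTop F p) ^ C * (gal F p τ M - M)) =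
      (p : BdRPlusTop F p) ^ A * ((p : BdRPlusTop F p) ^ N *
        (Pη (restrictedTateRep W F p σ (η.1 τ)) * (bω + Pω (κ.1 σ)) - Pω (restrictedTateRep W F p σ (η.1 τ)) * (bη + Pη (κ.1 σ)))) -
      of F p (qpToBdR ((ψ τ : ℤ_[p]) : ℚ_[p])) * (Λ + of F p (qpToBdR (a σ : ℚ_[p]) * tBdR)) -
      (p : BdRPlusTop F p) ^ C * (gal F p (σ * τ) M - gal F p σ M) := by
    simp only [map_sub, map_mul, map_pow, map_natCast, hPω, hPη, eω, eη, hΛgal, gal_gal, hgq]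
  rw [galRepr_apply, hgalE, hdι, e3, map_add, map_add, hψ, PadicInt.coe_add, map_add, map_add]
  linear_combination (-((p : BdRPlusTop F p) ^ A * (p : BdRPlusTop F p) ^ N)) * hL

include hPω hPη hLeg in
set_option maxHeartbeats 400000 in
/-- ★★ **The recognition identity from the `X₂`-membership of the Legendre resolution** (Kato II Lemma 1.4.3–1.4.5, `B_crys`-free, as a
REDUCTION). Let `Pω ⊆ Fil¹`, `Pη` be Legendre period data, `(b_ω, b_η)` an integrating pair of the cocycle `κ` with `θ(b_ω) = ι_F(c_P)`, `ψ`
an additive continuous `ℤ_p`-valued cochain, and assume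
(HT) `θ(Pη(η σ)) = θ(ψ σ)·ι_F(b) + (σ m − m)` for all `σ` (`b ∈ F`, `m ∈ ℂ_F`), and
(K₂) `p^N · x̃(η σ)`, `x̃(a) = Pη(a) b_ω − Pω(a) b_η`, is a Teichmüller logarithm modulo `Fil²` for every `σ`, `p`-adically small near `σ = 1`.
Then there are `k`, a unit `u` of `F` with `log_p u = p^k · (c_P b)`, a CONTINUOUS `h : Γ_F → ℤ_p(1)` and a `B_dR⁺`-cocycle `z` with the
recognition identity **`p^k · g(τ) − (ψ(τ)·ℓ_u + ι(h τ) + z(τ)) ∈ Fil² B_dR⁺`** for the Legendre cochain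
`g(τ) = Pη(η τ)·τ b_ω − Pω(η τ)·τ b_η` — exactly the data of `ReciprocityCalibrationSocket.tatePairingPoint_eq_neg_trace_of_recognition`, whose
conclusion is then `⟨[η], P⟩ = −Tr_{F/ℚ_p}(c_P · b)`. [cite: Kato1993LNM1553, Ch. II Lemma 1.4.3–1.4.5 and §1.4.4]
[cite: BlochKato1990, Ex. 3.10.1 and Example 3.11] [cite: FontaineOuyang2022, §6.1] -/
theorem exists_recognition_of_isTeichLog (hfil : ∀ a, Pω a ∈ (filOne F p).toIdeal)
    (η κ : contOneCocycles (restrictedTateRep W F p).toTopRep) {bω bη : BdRPlusTop F p}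
    (hbω : ∀ τ, Pω (κ.1 τ) = gal F p τ bω - bω) (hbη : ∀ τ, Pη (κ.1 τ) = gal F p τ bη - bη)
    {cP : F} (hθb : thetaBdR ((of F p).symm bω) = algebraMap F (CompletedAlgClosure F) cP)
    (ψ : C(absoluteGaloisGroup F, ℤ_[p])) (hψ : ∀ σ τ, ψ (σ * τ) = ψ σ + ψ τ)
    {b : F} {m : CompletedAlgClosure F}
    (hβ : ∀ σ, thetaBdR ((of F p).symm (Pη (η.1 σ))) =
      thetaBdR (qpToBdR (ψ σ : ℚ_[p]) : BDeRhamPlus (integerC F) p) * algebraMap F (CompletedAlgClosure F) b + (σ • m - m))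
    {N : ℕ} (hX : ∀ σ, IsTeichLog 2 ((of F p).symm ((p : BdRPlusTop F p) ^ N * (Pη (η.1 σ) * bω - Pω (η.1 σ) * bη))))
    (hXsmall : ∀ M' : ℕ, ∀ᶠ σ in 𝓝 (1 : absoluteGaloisGroup F), ∃ L' : BDeRhamPlus (integerC F) p, IsTeichLog 2 L' ∧
      (of F p).symm ((p : BdRPlusTop F p) ^ N * (Pη (η.1 σ) * bω - Pω (η.1 σ) * bη)) -
          (p : BDeRhamPlus (integerC F) p) ^ M' * L' ∈ Ideal.span {(xiBdR : BDeRhamPlus (integerC F) p) ^ 2}) :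
    ∃ (k : ℕ) (u : F) (hu : u ≠ 0) (hu1 : valuation F u = 1) (h : C(absoluteGaloisGroup F, (muPadicSystem F p).limit))
      (z : absoluteGaloisGroup F → BdRPlusTop F p),
      (letI := LocalField.padicAlgebra F p hp; letI := PadicField.normedField F p hp; unitLog u = ((p : ℚ_[p]) ^ k) • (cP * b)) ∧
      (∀ σ τ, z (σ * τ) = z σ + galRepr F p σ (z τ)) ∧
      ∀ τ, of F p (qpToBdR ((p : ℚ_[p]) ^ k)) * (Pη (η.1 τ) * gal F p τ bω - Pω (η.1 τ) * gal F p τ bη) -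
        (of F p (qpToBdR ((ψ τ : ℤ_[p]) : ℚ_[p])) *
            unitKummerLog hp hF hu (norm_algebraMap_normedAlgClosure_le_one_of_valuation_le_one hu1.le) +
          periodLine F p (h τ) + z τ) ∈ (WithIdeal.i ^ 2 : Ideal (BdRPlusTop F p)) := by
  letI := LocalField.padicAlgebra F p hp
  letI := PadicField.normedField F p hp
  haveI : CharZero (CompletedAlgClosure F) := charZero_of_injective_algebraMap (algebraMap F (CompletedAlgClosure F)).injective
  -- θ of the `ω`-periods vanishes; `ψ 1 = 0`
  have hθω : ∀ a, thetaBdR ((of F p).symm (Pω a)) = 0 := fun a => by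
    rw [← RingHom.mem_ker, ker_thetaBdR_eq_span]; exact (mem_filOne_iff).1 (hfil a)
  have hψ1 : ψ 1 = 0 := by
    have h := hψ 1 1
    rw [one_mul] at h
    exact left_eq_add.1 h
  -- (K₂) in distributed form
  have hX' : ∀ σ, IsTeichLog 2 ((p : BDeRhamPlus (integerC F) p) ^ N *
      ((of F p).symm (Pη (η.1 σ)) * (of F p).symm bω - (of F p).symm (Pω (η.1 σ)) * (of F p).symm bη)) := fun σ => by
    simpa only [map_mul, map_sub, map_pow, map_natCast] using hX σ
  have hXsmall' : ∀ M' : ℕ, ∀ᶠ σ in 𝓝 (1 : absoluteGaloisGroup F), ∃ L' : BDeRhamPlus (integerC F) p, IsTeichLog 2 L' ∧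
      (p : BDeRhamPlus (integerC F) p) ^ N *
          ((of F p).symm (Pη (η.1 σ)) * (of F p).symm bω - (of F p).symm (Pω (η.1 σ)) * (of F p).symm bη) -
        (p : BDeRhamPlus (integerC F) p) ^ M' * L' ∈ Ideal.span {(xiBdR : BDeRhamPlus (integerC F) p) ^ 2} := fun M' => by
    simpa only [map_mul, map_sub, map_pow, map_natCast] using hXsmall M'
  -- (IMAGE) `M ∈ X⁰₂` with `θ M = p^{N'} · ι(c_P) m`
  obtain ⟨N', M, hM, hθM⟩ := exists_isTeichLog_thetaBdR_eq_pow_mul hp (k := 2) (by norm_num)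
    (algebraMap F (CompletedAlgClosure F) cP * m)
  -- the calibration unit `u ≡ 1 (mod p)` with `log_p u = p^k (c_P b)`, `k = N + N' + j`
  obtain ⟨k, u, hk, husmall, hlog⟩ := PadicField.exists_one_unit_unitLog_eq_pow_smul hp (cP * b) (N + N')
  obtain ⟨hu0, hval, hu1, hx0⟩ := one_unit_props hp husmall
  obtain ⟨j, hj⟩ : ∃ j, k = N + N' + j := ⟨k - (N + N'), by omega⟩
  have hu0' : algebraMap F (NormedAlgClosure F) u ≠ 0 := (map_ne_zero_iff _ (algebraMap F (NormedAlgClosure F)).injective).2 hu0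
  -- the calibration element `Λ = ℓ_u + ι_F(log_p u)` and the Kummer exponent `a`
  obtain ⟨Λ, hΛdef⟩ : ∃ Λ : BdRPlusTop F p, Λ = unitKummerLog hp hF hu0 hu1 + of F p (embBdRHom hp hF (unitLog u)) := ⟨_, rfl⟩
  obtain ⟨a, ha⟩ : ∃ a : absoluteGaloisGroup F → ℤ_[p], ∀ σ, a σ = kummerExp (p := p) σ hu0' (NormedAlgClosure.smul_algebraMap σ u) :=
    ⟨_, fun _ => rfl⟩
  have hΛ' : (of F p).symm Λ = (of F p).symm (unitKummerLog hp hF hu0 hu1) + embBdRHom hp hF (unitLog u) := by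
    rw [hΛdef, map_add, RingEquiv.symm_apply_apply]
  have hΛteich : IsTeichLog 2 ((of F p).symm Λ) := by
    rw [hΛ']; exact isTeichLog_unitKummerLog_add_embBdRHom hp hF hu0 hu1 hx0 (by norm_num)
  have hΛθ : thetaBdR ((of F p).symm Λ) = (p : CompletedAlgClosure F) ^ k *
      (algebraMap F (CompletedAlgClosure F) cP * algebraMap F (CompletedAlgClosure F) b) := by
    rw [hΛ', thetaBdR_unitKummerLog_add_embBdRHom, hlog, Algebra.smul_def, map_pow, map_natCast, map_mul, map_pow, map_natCast,
      map_mul]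
  have hΛgal : ∀ σ, gal F p σ Λ = Λ + of F p (qpToBdR (a σ : ℚ_[p]) * tBdR) := fun σ => by
    rw [ha, hΛdef]; exact gal_unitKummerLog_add_embBdRHom hp hF hu0 hu1 σ
  have hgq : ∀ (σ : absoluteGaloisGroup F) (x : ℚ_[p]), gal F p σ (of F p (qpToBdR x)) = of F p (qpToBdR x) := fun σ x => by
    rw [gal_of, galBdRPlus_qpToBdR]
  have hge : ∀ σ : absoluteGaloisGroup F, gal F p σ (of F p (embBdRHom hp hF (unitLog u))) = of F p (embBdRHom hp hF (unitLog u)) :=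
    fun σ => by rw [gal_of, galBdRPlus_embBdRHom]
  -- the `M`-term
  have hθMgal : ∀ σ : absoluteGaloisGroup F, thetaBdR (galBdRPlus σ M) =
      (p : CompletedAlgClosure F) ^ N' * (algebraMap F (CompletedAlgClosure F) cP * σ • m) := fun σ => by
    rw [thetaBdR_galBdRPlus, hθM, smul_mul', smul_mul', smul_pow', ← map_natCast (algebraMap F (CompletedAlgClosure F)),
      CompletedAlgClosure.smul_algebraMap, CompletedAlgClosure.smul_algebraMap]
  have hC : ∀ σ : absoluteGaloisGroup F, IsTeichLog 2 (galBdRPlus σ M - M) := fun σ => by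
    rw [sub_eq_add_neg]; exact (hM.galBdRPlus σ).add hM.neg
  -- the ERROR COCHAIN `E`
  obtain ⟨E, hEdef⟩ : ∃ E : absoluteGaloisGroup F → BdRPlusTop F p, ∀ σ, E σ =
      (p : BdRPlusTop F p) ^ (N' + j) * ((p : BdRPlusTop F p) ^ N * (Pη (η.1 σ) * bω - Pω (η.1 σ) * bη)) -
        of F p (qpToBdR ((ψ σ : ℤ_[p]) : ℚ_[p])) * Λ - (p : BdRPlusTop F p) ^ (N + j) * (gal F p σ (of F p M) - of F p M) :=
    ⟨_, fun _ => rfl⟩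
  have hEsymm : ∀ σ, (of F p).symm (E σ) =
      (p : BDeRhamPlus (integerC F) p) ^ (N' + j) * ((p : BDeRhamPlus (integerC F) p) ^ N *
          ((of F p).symm (Pη (η.1 σ)) * (of F p).symm bω - (of F p).symm (Pω (η.1 σ)) * (of F p).symm bη)) -
        qpToBdR ((ψ σ : ℤ_[p]) : ℚ_[p]) * (of F p).symm Λ -
          (p : BDeRhamPlus (integerC F) p) ^ (N + j) * (galBdRPlus σ M - M) := fun σ => by
    rw [hEdef]
    simp only [map_sub, map_mul, map_pow, map_natCast, gal_of, RingEquiv.symm_apply_apply]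
  -- (1) `E` is `X⁰₂`-valued
  have hEteich : ∀ σ, IsTeichLog 2 ((of F p).symm (E σ)) := fun σ => by
    rw [hEsymm σ, sub_eq_add_neg, sub_eq_add_neg]
    exact (((hX' σ).prime_pow_mul _).add (hΛteich.padicInt_smul (ψ σ)).neg).add ((hC σ).prime_pow_mul _).neg
  -- (2) `θ ∘ E = 0`
  have hE0 : ∀ σ, thetaBdR ((of F p).symm (E σ)) = 0 := fun σ => by
    rw [hEsymm]
    simp only [map_sub, map_mul, map_pow, map_natCast, hθω, hθb, hβ, hΛθ, hθMgal, hθM, hj]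
    ring
  -- (3) `E` is `p`-adically small near `1`
  have hEsmall : ∀ M' : ℕ, ∀ᶠ σ in 𝓝 (1 : absoluteGaloisGroup F), ∃ L' : BDeRhamPlus (integerC F) p, IsTeichLog 2 L' ∧
      (of F p).symm (E σ) - (p : BDeRhamPlus (integerC F) p) ^ M' * L' ∈
        Ideal.span {(xiBdR : BDeRhamPlus (integerC F) p) ^ 2} := fun M' => by
    obtain ⟨U, hU⟩ := hM.exists_openSubgroup_gal_sub_mem M'
    have h3 : ∀ᶠ σ in 𝓝 (1 : absoluteGaloisGroup F), ∃ L₃ : BDeRhamPlus (integerC F) p, IsTeichLog 2 L₃ ∧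
        galBdRPlus σ M - M - (p : BDeRhamPlus (integerC F) p) ^ M' * L₃ ∈ Ideal.span {(xiBdR : BDeRhamPlus (integerC F) p) ^ 2} :=
      Filter.eventually_of_mem U.mem_nhds_one fun σ hσ => hU σ hσ
    filter_upwards [hXsmall' M', hΛteich.eventually_exists_eq_pow_mul ψ.continuous hψ1 M', h3] with σ h₁ h₂ h₃
    obtain ⟨L₁, hL₁, e₁⟩ := h₁
    obtain ⟨Y, hY, e₂⟩ := h₂
    obtain ⟨L₃, hL₃, e₃⟩ := h₃
    refine ⟨(p : BDeRhamPlus (integerC F) p) ^ (N' + j) * L₁ + -Y + -((p : BDeRhamPlus (integerC F) p) ^ (N + j) * L₃),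
      ((hL₁.prime_pow_mul _).add hY.neg).add (hL₃.prime_pow_mul _).neg, ?_⟩
    have eq : (of F p).symm (E σ) - (p : BDeRhamPlus (integerC F) p) ^ M' *
        ((p : BDeRhamPlus (integerC F) p) ^ (N' + j) * L₁ + -Y + -((p : BDeRhamPlus (integerC F) p) ^ (N + j) * L₃)) =
        (p : BDeRhamPlus (integerC F) p) ^ (N' + j) *
            ((p : BDeRhamPlus (integerC F) p) ^ N *
                ((of F p).symm (Pη (η.1 σ)) * (of F p).symm bω - (of F p).symm (Pω (η.1 σ)) * (of F p).symm bη) -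
              (p : BDeRhamPlus (integerC F) p) ^ M' * L₁) -
          (qpToBdR ((ψ σ : ℤ_[p]) : ℚ_[p]) * (of F p).symm Λ - (p : BDeRhamPlus (integerC F) p) ^ M' * Y) -
          (p : BDeRhamPlus (integerC F) p) ^ (N + j) *
            (galBdRPlus σ M - M - (p : BDeRhamPlus (integerC F) p) ^ M' * L₃) := by
      rw [hEsymm]; ring
    rw [eq, e₂, sub_self, sub_zero]
    exact Ideal.sub_mem _ (Ideal.mul_mem_left _ _ e₁) (Ideal.mul_mem_left _ _ e₃)
  -- (4) the twisted cochain identity `E(στ) = E σ + σ E τ + ι(d σ τ)`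
  obtain ⟨d, hddef⟩ : ∃ d : absoluteGaloisGroup F → absoluteGaloisGroup F → (muPadicSystem F p).limit, ∀ σ τ, d σ τ =
      epsLineEquiv F p (ψ τ * a σ) -
        (((p ^ (N' + j + N) : ℕ) : ℤ) • (weilContPairingPadic W F p e hμ hadd₁ hadd₂ hgal hcompat).toLin (κ.1 σ)
          (restrictedTateRep W F p σ (η.1 τ))) := ⟨_, fun _ _ => rfl⟩
  have hd : ∀ σ, Continuous (d σ) := fun σ => by
    have hde : d σ = fun τ => epsLineEquiv F p (ψ τ * a σ) -
        (((p ^ (N' + j + N) : ℕ) : ℤ) • (weilContPairingPadic W F p e hμ hadd₁ hadd₂ hgal hcompat).toLin (κ.1 σ)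
          (restrictedTateRep W F p σ (η.1 τ))) := funext (hddef σ)
    rw [hde]
    refine ((continuous_padicLineEquiv _ _).comp (ψ.continuous.mul continuous_const)).sub ?_
    exact ((weilContPairingPadic W F p e hμ hadd₁ hadd₂ hgal hcompat).continuous_toLin.comp
      (continuous_const.prodMk (((restrictedTateRep W F p).continuous_apply σ).comp η.1.continuous))).const_smul
      (((p ^ (N' + j + N) : ℕ) : ℤ))
  have hEcoch : ∀ σ τ, E (σ * τ) = E σ + galRepr F p σ (E τ) + periodLine F p (d σ τ) := fun σ τ => by
    rw [hEdef, hEdef, hEdef, hddef]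
    exact errorCochain_identity W e hμ hadd₁ hadd₂ hgal hcompat hPω hPη hLeg η κ hbω hbη ψ hψ hΛgal (N' + j) N (N + j) σ τ
  -- hence a CONTINUOUS correction cochain `h` with `p · E ≡ ι ∘ h (mod Fil²)`
  obtain ⟨h, hh⟩ := exists_continuous_periodLine_sub_mem_sq hp hF E hEteich hE0 hEsmall d hd hEcoch
  -- the power `u^p`: `ℓ_{u^p} = p ℓ_u + ι(ε^c)`, `log_p(u^p) = p^{k+1} (c_P b)`
  have hvalp : valuation F (u ^ p) = 1 := by rw [map_pow, hval, one_pow]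
  have hu1p : ‖algebraMap F (NormedAlgClosure F) (u ^ p)‖ ≤ 1 :=
    norm_algebraMap_normedAlgClosure_le_one_of_valuation_le_one hvalp.le
  obtain ⟨c, hc⟩ := exists_unitKummerLog_pow_eq hp hF hu0 hval hu1 p hu1p
  -- the corrected `h`, the cocycle `z`
  have hcont : Continuous fun τ => h τ - epsLineEquiv F p (ψ τ * c) + (((p ^ (k + 1) : ℕ) : ℤ) •
      (weilContPairingPadic W F p e hμ hadd₁ hadd₂ hgal hcompat).toLin (κ.1 τ) (η.1 τ)) := by
    refine (h.continuous.sub ((continuous_padicLineEquiv _ _).comp (ψ.continuous.mul continuous_const))).add ?_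
    exact ((weilContPairingPadic W F p e hμ hadd₁ hadd₂ hgal hcompat).continuous_toLin.comp
      (κ.1.continuous.prodMk η.1.continuous)).const_smul (((p ^ (k + 1) : ℕ) : ℤ))
  obtain ⟨z, hzdef⟩ : ∃ z : absoluteGaloisGroup F → BdRPlusTop F p, ∀ τ, z τ =
      of F p (qpToBdR ((ψ τ : ℤ_[p]) : ℚ_[p])) * ((p : BdRPlusTop F p) * of F p (embBdRHom hp hF (unitLog u))) +
        (p : BdRPlusTop F p) ^ (N + j + 1) * (gal F p τ (of F p M) - of F p M) := ⟨_, fun _ => rfl⟩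
  refine ⟨k + 1, u ^ p, pow_ne_zero p hu0, hvalp, ⟨_, hcont⟩, z, ?_, ?_, ?_⟩
  · -- `log_p (u^p) = p^{k+1} (c_P b)`
    rw [PadicField.unitLog_pow F p hp hval p, hlog, Algebra.smul_def, Algebra.smul_def, map_pow, map_pow, map_natCast, pow_succ]
    ring
  · -- `z` is a cocycle
    intro σ τ
    simp only [hzdef, galRepr_apply, hψ, PadicInt.coe_add, map_add, map_sub, map_mul, map_pow, map_natCast, hgq, hge, gal_gal]
    ring
  · -- the recognition identity: it IS `p · E τ − ι(h τ)`
    intro τ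
    have eg := legendreCochain_eq_resolution_add_periodLine W e hμ hadd₁ hadd₂ hgal hcompat hLeg η κ hbω hbη τ
    have key : (p : BdRPlusTop F p) * E τ - periodLine F p (h τ) =
        of F p (qpToBdR ((p : ℚ_[p]) ^ (k + 1))) * (Pη (η.1 τ) * gal F p τ bω - Pω (η.1 τ) * gal F p τ bη) -
        (of F p (qpToBdR ((ψ τ : ℤ_[p]) : ℚ_[p])) *
            unitKummerLog hp hF (pow_ne_zero p hu0) (norm_algebraMap_normedAlgClosure_le_one_of_valuation_le_one hvalp.le) +
          periodLine F p (h τ - epsLineEquiv F p (ψ τ * c) + (((p ^ (k + 1) : ℕ) : ℤ) •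
            (weilContPairingPadic W F p e hμ hadd₁ hadd₂ hgal hcompat).toLin (κ.1 τ) (η.1 τ))) + z τ) := by
      rw [eg, hc, hEdef, hΛdef, hzdef]
      simp only [map_add, map_sub, map_zsmul, periodLine_epsLineEquiv, PadicInt.coe_mul, map_mul, zsmul_eq_mul, Int.cast_natCast,
        Int.cast_pow, Nat.cast_pow, map_pow, map_natCast, hj]
      ring
    exact key ▸ hh τ

end Recognition

end BdRPlusTop

end Literature.NumberTheory.PAdicHodge

end
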